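import Mathlib
import Summits.Ventures.PercRepro2.Defs
import Summits.Ventures.PercRepro2.Graph
import Summits.Ventures.PercRepro2.OneColourSwitch
import Summits.Ventures.PercRepro2.RegionHubSign
import Summits.Ventures.PercRepro2.SideSwitch
import Summits.Ventures.PercRepro2.SideSwitchComps
import Summits.Ventures.PercRepro2.SideSwitchM9
import Summits.Ventures.PercRepro2.TermSwitchDefs
import Summits.Ventures.PercRepro2.TermSwitchFibre
import Summits.Ventures.PercRepro2.TermSwitchCompsFibre
import Summits.Ventures.PercRepro2.TermSwitchMono
import Summits.Ventures.PercRepro2.TermSwitchM9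
import Summits.Ventures.PercRepro2.TermSwitchRestrict
import Summits.Ventures.PercRepro2.M9NoPocketDefs
import Summits.Ventures.PercRepro2.M9YSliceDefs
import Summits.Ventures.PercRepro2.M9YSliceOD
import Summits.Ventures.PercRepro2.M9YSliceOF

/-!
# The per-pair Harris inequality of the unreached half (blind cell PercRepro2, p3 g26,
2026-08-28; `proofs/P3-YSLICE.md` §3(O), part 3)

For a slice representative `ρ` of `G − d` (`M9YSliceOD`, `M9YSliceOF`) with no neighbour of `d`
a terminal, pair `ρ` with `φρ` and write the assignments containing `N` (the components holding
a neighbour of `d`) as `N ∪ T'`, `T' ⊆ A' = A ∖ N`.  The paired kernel is `D(T') · S(T')` with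
`D(T') = G⁺(T') − G(A ∖ (N ∪ T'))` (`gPlus`: `p ~_Y q` in `G` at `ρ`, `φρ`; `gMinus`: in
`G − d`) and `S(T') = σ_rs(G − d)` at `N ∪ T'` (`sK`).  `D` is increasing
(`conn_pq_assignC_mono_star`: the `Y`-connection of `p, q` in `G` is increasing along the
sub-cube, by the lane's path transfer once the worlds of `G` and `G − d` are identified) with
`D + D ∘ κ ≥ 0` (`gMinus_le_gPlus`, `G` increasing), `S` is decreasing with `S + S ∘ κ ≤ 0`
(the `rs`-sign at the complementary assignment is the opposite sign, `sigma_rs_assignC_sdiff`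
in `G − d`, which has no `r–s` edge either: `endsD_ne_pair`), and Harris on the cube `2^{A'}`
(`SideSwitch.harris_powerset`) gives `Σ D · S ≤ 0` (`pair_sum_nonpos`).  Own work; std axioms.
-/

namespace Summit.Ventures.PercRepro2

namespace NoPocket

open Finset Classical RegionHub OneColourSwitch SideSwitch TermSwitch

variable {V : Type*} {E : Type*}
variable [Fintype V] [DecidableEq V] [Fintype E] [DecidableEq E]

section Mono

variable {ends : E → Sym2 V}

/-- On the sub-cube of a slice representative, `d` is unreached in `G`. -/
lemma not_mem_K2_assignC_star {p q r s d : V} (hr : d ≠ r) (hs : d ≠ s) {ρ : Config E}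
    (hρ : ρ ∈ RepH (endsD ends d) p q ({r, s} : Set V)) (hY : StarY ends d ρ)
    (hH : NoNbH ends r s d) {T : Finset (Finset V)}
    (hT : T ⊆ compsH (endsD ends d) ({r, s} : Set V) ρ) (hN : nbComps ends r s d ρ ⊆ T) :
    d ∉ K2 ends r s (assignC (endsD ends d) T ρ) :=
  (not_mem_K2_iff_noNbK hr hs ((starY_assignC_endsD hr hs hT).2 hY)).2
    ((noNbK_assignC_iff hρ hT).2 ⟨hH, hN⟩)

/-- **The `Y`-connection of `p, q` in `G` is increasing along the sub-cube** of a slice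
representative of `G − d`. -/
lemma conn_pq_assignC_mono_star {p q r s d : V} (hr : d ≠ r) (hs : d ≠ s) {ρ : Config E}
    (hρ : ρ ∈ RepH (endsD ends d) p q ({r, s} : Set V)) (hY : StarY ends d ρ)
    (hH : NoNbH ends r s d) {T T' : Finset (Finset V)} (hTT : T ⊆ T')
    (hT' : T' ⊆ compsH (endsD ends d) ({r, s} : Set V) ρ) (hN : nbComps ends r s d ρ ⊆ T)
    (hc : Conn ends (assignC (endsD ends d) T ρ) p q) :
    Conn ends (assignC (endsD ends d) T' ρ) p q := by
  have hT : T ⊆ compsH (endsD ends d) ({r, s} : Set V) ρ := hTT.trans hT'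
  have hdK := not_mem_K2_assignC_star hr hs hρ hY hH hT hN
  have hKeq : K2 ends r s (assignC (endsD ends d) T ρ) =
      K2 (endsD ends d) r s (assignC (endsD ends d) T ρ) := K2_endsD_of_not_mem hdK
  have hsep : sepH (endsD ends d) p q ({r, s} : Set V) (assignC (endsD ends d) T ρ) :=
    sepH_assignC (mem_RepH.1 hρ).1 hT
  refine conn_of_eqOn_notTouches (H := ({r, s} : Set V)) (ω := assignC (endsD ends d) T ρ)
    (ω' := assignC (endsD ends d) T' ρ) ?_ ?_ hc
  · show p ∉ K2 ends r s (assignC (endsD ends d) T ρ)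
    rw [hKeq]
    exact hsep.1
  · intro e he
    refine assign_eq_of_notMem_touches_sdiff (unionT_mono hTT) ?_
    rintro ⟨x, hx, y, hxy⟩
    have hx' : x ∈ unionT T' \ unionT T := Finset.mem_coe.1 hx
    have hxK : x ∈ KH (endsD ends d) ({r, s} : Set V) (assignC (endsD ends d) T ρ) :=
      (sideC_of_mem_sdiff_H hρ hTT hT' hx').1
    have hxA : x ∈ A0H (endsD ends d) ({r, s} : Set V) ρ :=
      unionT_subset_A0H hT' (Finset.mem_sdiff.1 hx').1
    have hde : d ∉ ends e := by
      intro hde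
      rw [endsD_of_mem hde, Sym2.eq_iff] at hxy
      have hxd : x = d := by
        rcases hxy with ⟨h, _⟩ | ⟨_, h⟩ <;> exact h.symm
      subst hxd
      exact d_not_mem_A0H_endsD hr hs ρ hxA
    apply he
    refine ⟨x, ?_, y, ?_⟩
    · show x ∈ K2 ends r s (assignC (endsD ends d) T ρ)
      rw [hKeq]; exact hxK
    · rw [← endsD_of_notMem hde]; exact hxy

omit [Fintype V] [DecidableEq V] [Fintype E] [DecidableEq E] in
/-- Without `r–s` edges in `G`, there are none in `G − d`. -/
lemma endsD_ne_pair {r s d : V} (hr : d ≠ r) (hrs : ∀ e, ends e ≠ s(r, s)) (e : E) :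
    endsD ends d e ≠ s(r, s) := by
  by_cases hde : d ∈ ends e
  · rw [endsD_of_mem hde]
    intro h
    rw [Sym2.eq_iff] at h
    rcases h with ⟨h, _⟩ | ⟨_, h⟩ <;> exact hr h
  · rw [endsD_of_notMem hde]; exact hrs e

end Mono

section Pair

variable {ends : E → Sym2 V}

/-- `G⁺(T')`: the `Y`-connections of `p, q` in `G` at the assignments `N ∪ T'` of `ρ` and `φρ`. -/
noncomputable def gPlus (ends : E → Sym2 V) (p q r s d : V) (ρ : Config E)
    (N T' : Finset (Finset V)) : ℤ :=
  (if Conn ends (assignC (endsD ends d) (N ∪ T') ρ) p q then (1 : ℤ) else 0) +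
    (if Conn ends (assignC (endsD ends d) (N ∪ T') (phiO ends r s d ρ)) p q then 1 else 0)

/-- `G(U)`: the `Y`-connections of `p, q` in `G − d` at the assignments `U` of `ρ` and `φρ`. -/
noncomputable def gMinus (ends : E → Sym2 V) (p q r s d : V) (ρ : Config E)
    (U : Finset (Finset V)) : ℤ :=
  (if Conn (endsD ends d) (assignC (endsD ends d) U ρ) p q then (1 : ℤ) else 0) +
    (if Conn (endsD ends d) (assignC (endsD ends d) U (phiO ends r s d ρ)) p q then 1 else 0)

/-- `S(T')`: the `rs`-sign of `G − d` at the assignment `N ∪ T'`. -/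
noncomputable def sK (ends : E → Sym2 V) (r s d : V) (ρ : Config E)
    (N T' : Finset (Finset V)) : ℤ :=
  sigma (endsD ends d) (assignC (endsD ends d) (N ∪ T') ρ) r s

omit [DecidableEq E] in
/-- `G ≤ G⁺` pointwise. -/
lemma gMinus_le_gPlus (p q r s d : V) (ρ : Config E) (N T' : Finset (Finset V)) :
    gMinus ends p q r s d ρ (N ∪ T') ≤ gPlus ends p q r s d ρ N T' := by
  unfold gMinus gPlus
  exact add_le_add (ite_le_ite_of_imp conn_of_conn_endsD) (ite_le_ite_of_imp conn_of_conn_endsD)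

omit [Fintype V] in
/-- The sub-cube complement inside the cube. -/
lemma sdiff_union_eq (A N T' : Finset (Finset V)) :
    A \ (N ∪ T') = (A \ N) \ T' := by
  ext x
  simp only [Finset.mem_sdiff, Finset.mem_union, not_or]
  tauto

omit [Fintype V] in
/-- The sub-cube complement of the complement. -/
lemma sdiff_union_sdiff_eq {A N T' : Finset (Finset V)} (hT' : T' ⊆ A \ N) :
    A \ (N ∪ ((A \ N) \ T')) = T' := by
  ext x
  simp only [Finset.mem_sdiff, Finset.mem_union, not_or, not_and, not_not]
  constructor
  · rintro ⟨hxA, hxN, h⟩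
    exact h ⟨hxA, hxN⟩
  · intro hx
    have := hT' hx
    rw [Finset.mem_sdiff] at this
    exact ⟨this.1, this.2, fun _ => hx⟩

/-- **The per-pair Harris inequality on the sub-cube**: for a slice representative `ρ` of
`G − d` with no neighbour of `d` a terminal and no `r–s` edge,
`Σ_{T' ⊆ A ∖ N} (G⁺(T') − G(A ∖ (N ∪ T'))) · S(T') ≤ 0`. -/
lemma pair_sum_nonpos {p q r s d : V} (hr : d ≠ r) (hs : d ≠ s) (hrs : ∀ e, ends e ≠ s(r, s))
    {ρ : Config E} (hρ : ρ ∈ RepH (endsD ends d) p q ({r, s} : Set V)) (hY : StarY ends d ρ)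
    (hH : NoNbH ends r s d) :
    ∑ T' ∈ (compsH (endsD ends d) ({r, s} : Set V) ρ \ nbComps ends r s d ρ).powerset,
      (gPlus ends p q r s d ρ (nbComps ends r s d ρ) T' -
        gMinus ends p q r s d ρ (compsH (endsD ends d) ({r, s} : Set V) ρ \
          (nbComps ends r s d ρ ∪ T'))) *
        sK ends r s d ρ (nbComps ends r s d ρ) T' ≤ 0 := by
  set A := compsH (endsD ends d) ({r, s} : Set V) ρ with hA
  set N := nbComps ends r s d ρ with hNdef
  have hNA : N ⊆ A := Finset.filter_subset _ _
  set A' := A \ N with hA'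
  have hρ' : phiO ends r s d ρ ∈ RepH (endsD ends d) p q ({r, s} : Set V) := phiO_mem_RepH hρ
  have hY' : StarY ends d (phiO ends r s d ρ) := starY_phiO r s d ρ
  have hcomps' : compsH (endsD ends d) ({r, s} : Set V) (phiO ends r s d ρ) = A :=
    compsH_phiO r s d ρ
  have hN' : nbComps ends r s d (phiO ends r s d ρ) = N := nbComps_phiO r s d ρ
  have hrH : r ∈ ({r, s} : Set V) := Set.mem_insert r _
  have hrsD : ∀ e, endsD ends d e ≠ s(r, s) := endsD_ne_pair hr hrs
  -- the cube of the free components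
  let Dk : Finset (Finset V) → ℤ := fun T' =>
    gPlus ends p q r s d ρ N T' - gMinus ends p q r s d ρ (A \ (N ∪ T'))
  let Sk : Finset (Finset V) → ℤ := fun T' => sK ends r s d ρ N T'
  have hsub : ∀ T' ⊆ A', N ∪ T' ⊆ A := fun T' hT' =>
    Finset.union_subset hNA (hT'.trans Finset.sdiff_subset)
  -- (i) `G⁺` increasing, `G` increasing
  have hGp : ∀ T' T'', T' ⊆ T'' → T'' ⊆ A' →
      gPlus ends p q r s d ρ N T' ≤ gPlus ends p q r s d ρ N T'' := by
    intro T' T'' h1 h2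
    unfold gPlus
    have hTT : N ∪ T' ⊆ N ∪ T'' := Finset.union_subset_union (Finset.Subset.refl N) h1
    refine add_le_add (ite_le_ite_of_imp ?_) (ite_le_ite_of_imp ?_)
    · exact conn_pq_assignC_mono_star hr hs hρ hY hH hTT (hsub T'' h2) Finset.subset_union_left
    · refine conn_pq_assignC_mono_star hr hs hρ' hY' hH hTT ?_ ?_
      · rw [hcomps']; exact hsub T'' h2
      · rw [hN']; exact Finset.subset_union_left
  have hGm : ∀ U U', U ⊆ U' → U' ⊆ A →
      gMinus ends p q r s d ρ U ≤ gMinus ends p q r s d ρ U' := by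
    intro U U' h1 h2
    unfold gMinus
    refine add_le_add (ite_le_ite_of_imp (conn_pq_assignC_mono_H hρ h1 h2))
      (ite_le_ite_of_imp (conn_pq_assignC_mono_H hρ' h1 ?_))
    rw [hcomps']; exact h2
  have hDmono : ∀ T' T'', T' ⊆ T'' → T'' ⊆ A' → Dk T' ≤ Dk T'' := by
    intro T' T'' h1 h2
    have e1 := hGp T' T'' h1 h2
    have e2 := hGm (A \ (N ∪ T'')) (A \ (N ∪ T'))
      (Finset.sdiff_subset_sdiff (Finset.Subset.refl A)
        (Finset.union_subset_union (Finset.Subset.refl N) h1)) Finset.sdiff_subset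
    simp only [Dk]
    linarith
  -- (ii) `D + D ∘ κ ≥ 0`
  have hDκ : ∀ T' ⊆ A', 0 ≤ Dk T' + Dk (A' \ T') := by
    intro T' hT'
    simp only [Dk]
    rw [sdiff_union_eq, sdiff_union_sdiff_eq hT']
    have a1 := gMinus_le_gPlus (ends := ends) p q r s d ρ N T'
    have a2 := gMinus_le_gPlus (ends := ends) p q r s d ρ N (A' \ T')
    have b1 := hGm T' (N ∪ T') Finset.subset_union_right (hsub T' hT')
    have b2 := hGm (A' \ T') (N ∪ (A' \ T')) Finset.subset_union_right
      (hsub (A' \ T') Finset.sdiff_subset)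
    linarith
  -- (iii) `S` decreasing
  have hSanti : ∀ T' T'', T' ⊆ T'' → T'' ⊆ A' → Sk T'' ≤ Sk T' := by
    intro T' T'' h1 h2
    simp only [Sk, sK]
    have hTT : N ∪ T' ⊆ N ∪ T'' := Finset.union_subset_union (Finset.Subset.refl N) h1
    unfold sigma
    exact sub_le_sub (ite_le_ite_of_imp (conn_rs_assignC_anti_H hρ hrH s hTT (hsub T'' h2)))
      (ite_le_ite_of_imp (conn_rs_compl_assignC_mono_H hρ hrH s hTT (hsub T'' h2)))
  -- (iv) `S + S ∘ κ ≤ 0`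
  have hSκ : ∀ T' ⊆ A', Sk T' + Sk (A' \ T') ≤ 0 := by
    intro T' hT'
    simp only [Sk, sK]
    have hc : sigma (endsD ends d) (assignC (endsD ends d) (N ∪ (A' \ T')) ρ) r s =
        - sigma (endsD ends d) (assignC (endsD ends d) T' ρ) r s := by
      have h := sigma_rs_assignC_sdiff hρ hrsD (T := T') (hT'.trans Finset.sdiff_subset)
      rw [← hA] at h
      have e : N ∪ (A' \ T') = A \ T' := by
        ext x
        simp only [hA', Finset.mem_union, Finset.mem_sdiff]
        constructor
        · rintro (h | ⟨⟨h1, _⟩, h2⟩)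
          · exact ⟨hNA h, fun h' => (Finset.mem_sdiff.1 (hT' h')).2 h⟩
          · exact ⟨h1, h2⟩
        · rintro ⟨h1, h2⟩
          by_cases hN : x ∈ N
          · exact Or.inl hN
          · exact Or.inr ⟨⟨h1, hN⟩, h2⟩
      rw [e]; exact h
    rw [hc]
    have hanti : sigma (endsD ends d) (assignC (endsD ends d) (N ∪ T') ρ) r s ≤
        sigma (endsD ends d) (assignC (endsD ends d) T' ρ) r s := by
      unfold sigma
      exact sub_le_sub (ite_le_ite_of_imp (conn_rs_assignC_anti_H hρ hrH s
        Finset.subset_union_right (hsub T' hT')))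
        (ite_le_ite_of_imp (conn_rs_compl_assignC_mono_H hρ hrH s
          Finset.subset_union_right (hsub T' hT')))
    linarith
  -- (v) Harris on the cube `2^{A'}`
  have hD0 : 0 ≤ ∑ T' ∈ A'.powerset, Dk T' := by
    have h := sum_powerset_sdiff A' Dk
    have h2 : 0 ≤ ∑ T' ∈ A'.powerset, (Dk T' + Dk (A' \ T')) :=
      Finset.sum_nonneg (fun T' hT' => hDκ T' (Finset.mem_powerset.1 hT'))
    rw [Finset.sum_add_distrib, h] at h2
    linarith
  have hS0 : ∑ T' ∈ A'.powerset, Sk T' ≤ 0 := by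
    have h := sum_powerset_sdiff A' Sk
    have h2 : ∑ T' ∈ A'.powerset, (Sk T' + Sk (A' \ T')) ≤ 0 :=
      Finset.sum_nonpos (fun T' hT' => hSκ T' (Finset.mem_powerset.1 hT'))
    rw [Finset.sum_add_distrib, h] at h2
    linarith
  have hH := harris_powerset A' Dk (fun T' => - Sk T') hDmono (fun T' T'' h1 h2 => by
    have := hSanti T' T'' h1 h2
    linarith)
  have hneg : ∑ T' ∈ A'.powerset, (- Sk T') = - ∑ T' ∈ A'.powerset, Sk T' :=
    Finset.sum_neg_distrib Sk
  have hprod : ∑ T' ∈ A'.powerset, Dk T' * (- Sk T') = - ∑ T' ∈ A'.powerset, Dk T' * Sk T' := by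
    rw [← Finset.sum_neg_distrib]
    exact Finset.sum_congr rfl (fun T' _ => by ring)
  rw [hneg, hprod] at hH
  have hpos : (0 : ℤ) < 2 ^ A'.card := pow_pos two_pos _
  have hmul : 0 ≤ (∑ T' ∈ A'.powerset, Dk T') * (- ∑ T' ∈ A'.powerset, Sk T') :=
    mul_nonneg hD0 (by linarith)
  show ∑ T' ∈ A'.powerset, Dk T' * Sk T' ≤ 0
  nlinarith

end Pair


end NoPocket

end Summit.Ventures.PercRepro2
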